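import Summits.BirchSwinnertonDyer.BirchSwinnertonDyer.Theses.TameQuarticManinParity
import HarnessLib

/-!
# Route `TameQuarticManinParity`, LINE 25 (bsd-idea-3 g8), glue K25 `TprimeIrrOrientationOfManinTwistEquality`
# (stmt-BirchSwinnertonDyer-22696) — PROVED BY NAME: the Manin dictionary «equal optimal Manin constants on the
# (III, III*) twist pair ⟹ the orientation inclusion», granted the twisted Néron lattice law T24L as a hypothesis

Cell `pub/bsd-wall`, D-0145 line `route-BirchSwinnertonDyer-TeichmullerTwistDescent`, seat `bsd-line-ttd-p1` g10,
working the planner-of-record's TQMP LINE 25 (proof = the planner's sketch `ideas/l25/Sketch25.lean`, re-checked). BSD is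
NOT proved by this; Manin's conjecture is not proved by this; T24L (`TprimeIrrOptimalTwistNeronLattice`, stmt-22694) is
a HYPOTHESIS of the statement and stays OPEN; O22 stays OPEN.

## Statement (the route decl, paraphrased)

`TprimeIrrOptimalTwistNeronLattice →` for W type III irreducible (t′) with an optimal (lattice-exact, minimal-degree)
datum `D`, `A` with an optimal datum `D'` for `D.f ⊗ χ₋₃`, `D.c ≠ 0` and `D.c = ±D'.c`:
`Λ(D.f) ⊆ g(χ)·Λ(D.f ⊗ χ)`.

## Proof

`z ∈ Λ(f)` ⇒ `c·z ∈ Λ(W)` (`smul_periodLattice_le`) ⇒ `c·z/g ∈ Λ(A)` (T24L) ⇒ `c·z/g = c'·w`, `w ∈ Λ(f ⊗ χ)`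
(exactness of `D'`) ⇒ `z = ±g·w`. Design: theorems only; no definition, no named fact, no `sorry`; axioms `propext`,
`Classical.choice`, `Quot.sound`.
-/

set_option autoImplicit false
-- D-0017: single-problem summit, so `Summit.BirchSwinnertonDyer.BirchSwinnertonDyer.…` repeats a namespace BY DESIGN.
set_option linter.dupNamespace false

noncomputable section

open scoped Classical

namespace Summit.BirchSwinnertonDyer.BirchSwinnertonDyer.Theorems.TameQuarticManinParity

open Literature.NumberTheory.EllipticCurves Literature.NumberTheory.EllipticCurves.ModularForms
  Summit.BirchSwinnertonDyer.BirchSwinnertonDyer.Theses.TameQuarticManinParity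

/-- **Glue K25 `TprimeIrrOrientationOfManinTwistEquality`** (stmt-BirchSwinnertonDyer-22696), by name: granted T24L,
equal (up to sign) optimal Manin constants on the twist pair give the orientation inclusion `Λ(D.f) ⊆ g(χ)·Λ(D.f ⊗ χ)`.
[cite: Stevens1989, Lemmas (5.2), (5.4)] -/
theorem tprimeIrrOrientationOfManinTwistEquality_proof : TprimeIrrOrientationOfManinTwistEquality := by
  unfold TprimeIrrOrientationOfManinTwistEquality
  intro hT W _ _ _ hcm hadd ht hirr h3 D hex hmin h9 χ hχ hprim A _ _ D' hf hex' hmin' hc hcc z hz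
  have hg : gaussSum χ (ZMod.stdAddChar (N := 3)) ≠ 0 := gaussSum_stdAddChar_ne_zero_of_isPrimitive hprim
  have hc' : (D.c : ℂ) ≠ 0 := by exact_mod_cast hc
  have h1 : (D.c : ℂ) * z ∈ D.L.lattice := D.smul_periodLattice_le z hz
  have hgy : gaussSum χ (ZMod.stdAddChar (N := 3)) * ((D.c : ℂ) * z / gaussSum χ (ZMod.stdAddChar (N := 3)))
      = (D.c : ℂ) * z := by
    field_simp
  have hy : (D.c : ℂ) * z / gaussSum χ (ZMod.stdAddChar (N := 3)) ∈ D'.L.lattice := by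
    have hiff := hT W hcm hadd ht hirr h3 D hex hmin h9 χ hχ hprim A D' hf hex' hmin'
      ((D.c : ℂ) * z / gaussSum χ (ZMod.stdAddChar (N := 3)))
    rw [hiff, hgy]; exact h1
  obtain ⟨w, hw, hyw⟩ := hex' _ hy
  rw [hf] at hw
  rcases hcc with hcc | hcc
  · refine ⟨w, hw, ?_⟩
    have e : (D'.c : ℂ) = (D.c : ℂ) := by exact_mod_cast hcc.symm
    apply mul_left_cancel₀ hc'
    calc (D.c : ℂ) * z
        = gaussSum χ (ZMod.stdAddChar (N := 3)) * ((D.c : ℂ) * z / gaussSum χ (ZMod.stdAddChar (N := 3))) :=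
          hgy.symm
      _ = gaussSum χ (ZMod.stdAddChar (N := 3)) * ((D'.c : ℂ) * w) := by rw [hyw]
      _ = (D.c : ℂ) * (gaussSum χ (ZMod.stdAddChar (N := 3)) * w) := by rw [e]; ring
  · refine ⟨-w, neg_mem hw, ?_⟩
    have e0 : (D.c : ℂ) = -(D'.c : ℂ) := by exact_mod_cast hcc
    have e : (D'.c : ℂ) = -(D.c : ℂ) := by rw [e0, neg_neg]
    apply mul_left_cancel₀ hc'
    calc (D.c : ℂ) * z
        = gaussSum χ (ZMod.stdAddChar (N := 3)) * ((D.c : ℂ) * z / gaussSum χ (ZMod.stdAddChar (N := 3))) :=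
          hgy.symm
      _ = gaussSum χ (ZMod.stdAddChar (N := 3)) * ((D'.c : ℂ) * w) := by rw [hyw]
      _ = (D.c : ℂ) * (gaussSum χ (ZMod.stdAddChar (N := 3)) * -w) := by rw [e]; ring

end Summit.BirchSwinnertonDyer.BirchSwinnertonDyer.Theorems.TameQuarticManinParity

end
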